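import Mathlib
import HarnessLib
import Literature.Analysis.FluidPDE.SereginEpsilonRegularityHigherHolds
import Literature.Analysis.FluidPDE.BlowupFarField

/-!
# Route `AxisTwistDoor`, crux `AveragedConeLiouville` (stmt-NavierStokesRegularity-26889) — toward replacing the
# Lei–Ren input (programme R2), piece S5″: SMOOTH BOUNDED REPRESENTATIVE AT A SMALL SCALE

The one-scale smallness of `C + D` delivered for the approximants by piece S5′ (`…SmallScales.eventually_small_cknC_add_cknD`)
is turned into quantitative smoothness by the tree's PROVED higher ε-regularity `seregin2014_lemma61_holds` (Seregin 2014,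
Lemma 6.1): after re-centring (`IsSuitableWeakSolutionInBall.of_subset_zero`) and zooming `Q(z, s) → Q(0, 1)`
(`IsSuitableWeakSolutionInBall.zoom`; `C`, `D` are scale invariant, `cknC_nsZoom`, `cknD_nsZoom`), the zoomed velocity
`s · v(z.1 + s²τ, z.2 + s y)` has, on `Q(0, 1/2)`, a representative all of whose spatial derivatives are bounded by
universal constants:

* `exists_smooth_rep_of_small` — there are universal `ε > 0` and `c₀ : ℕ → ℝ` such that for `(v, q)` in Albritton–Barker's
  class on `Q(0,1)`, a cylinder `Q(z, s) ⊆ Q(0,1)` and `C(s; z)(v) + D(s; z)(q) ≤ ε`, the zoomed velocity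
  `s • stPull (s²) s z.1 z.2 v` agrees a.e. on `Q(0, 1/2)` with a function `W`, smooth in space, Hölder in space-time,
  with `‖∇ᵏ_y W(τ, y)‖ ≤ c₀ k` on `Q(0, 1/2)` for every `k`.

Un-zooming (for the CONTINUOUS class profiles: `|v| ≤ c₀ 0 / s`, `|∇v| ≤ c₀ 1 / s²` pointwise on `Q(z, s/2)`) is left to
the assembly piece S6.  Seat ns-atd-p1 (LEAD g2).  WHAT THIS IS NOT: not a statement about Navier–Stokes regularity; a
compactness tool serving a STAGED door route.  Lands `--supports` the crux item as a helper.
-/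

noncomputable section

set_option linter.dupNamespace false

namespace Summit.NavierStokesRegularity.NavierStokesRegularity.Theorems.AveragedConeLiouville.SmoothRep

open scoped ENNReal NNReal Topology
open Set Function MeasureTheory Metric Filter TopologicalSpace
open Literature.Analysis.FluidPDE

/-- **Smooth bounded representative at a small scale** (Seregin 2014, Lemma 6.1, transported by the Navier–Stokes
scaling to a cylinder `Q(z, s) ⊆ Q(0, 1)`; statement for the ZOOMED velocity). [cite: Seregin2014, Ch. 6 §6.1
Lemma 6.1] -/
theorem exists_smooth_rep_of_small : ∃ ε : ℝ, 0 < ε ∧ ∃ c₀ : ℕ → ℝ,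
    ∀ (v : ℝ → EuclideanSpace ℝ (Fin 3) → EuclideanSpace ℝ (Fin 3)) (q : ℝ → EuclideanSpace ℝ (Fin 3) → ℝ)
      (z : ℝ × EuclideanSpace ℝ (Fin 3)) (s : ℝ), 0 < s →
      IsSuitableWeakSolutionInBall 1 (0 : ℝ × EuclideanSpace ℝ (Fin 3)) v q →
      parabolicCylinder s z ⊆ parabolicCylinder 1 (0 : ℝ × EuclideanSpace ℝ (Fin 3)) →
      cknC s z v + cknD s z q ≤ ENNReal.ofReal ε →
      ∃ W : ℝ → EuclideanSpace ℝ (Fin 3) → EuclideanSpace ℝ (Fin 3),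
        uncurry (s • stPull (s ^ 2) s z.1 z.2 v) =ᵐ[volume.restrict
          (parabolicCylinder (1 / 2) (0 : ℝ × EuclideanSpace ℝ (Fin 3)))] uncurry W ∧
        (∀ w ∈ parabolicCylinder (1 / 2) (0 : ℝ × EuclideanSpace ℝ (Fin 3)), ContDiffAt ℝ ((⊤ : ℕ∞) : WithTop ℕ∞) (W w.1) w.2) ∧
        ∀ k : ℕ,
          (∃ C α : ℝ≥0, 0 < α ∧ HolderOnWith C α
            (fun w : ℝ × EuclideanSpace ℝ (Fin 3) => iteratedFDeriv ℝ k (W w.1) w.2)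
            (parabolicCylinder (1 / 2) (0 : ℝ × EuclideanSpace ℝ (Fin 3)))) ∧
          ∀ w ∈ parabolicCylinder (1 / 2) (0 : ℝ × EuclideanSpace ℝ (Fin 3)),
            ‖iteratedFDeriv ℝ k (W w.1) w.2‖ ≤ c₀ k := by
  obtain ⟨ε₀, hε₀, c₀, H⟩ := seregin2014_lemma61_holds
  refine ⟨ε₀ / 2, by positivity, c₀, fun v q z s hs hIB hsub hsmall => ?_⟩
  -- re-centre and zoom
  have hIBz : IsSuitableWeakSolutionInBall s z v q := hIB.of_subset_zero hs hsub
  have hIB1 := hIBz.zoom hs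
  set V : ℝ → EuclideanSpace ℝ (Fin 3) → EuclideanSpace ℝ (Fin 3) := s • stPull (s ^ 2) s z.1 z.2 v with hV
  set P : ℝ → EuclideanSpace ℝ (Fin 3) → ℝ := s ^ 2 • stPull (s ^ 2) s z.1 z.2 q with hP
  -- the scale-invariant quantities
  have hz : stAffine (s ^ 2) s z.1 z.2 (0 : ℝ × EuclideanSpace ℝ (Fin 3)) = z :=
    Prod.ext (by simp [stAffine]) (by simp [stAffine])
  have hC : cknC 1 0 V = cknC s z v := by
    rw [hV, cknC_nsZoom hs one_pos z.1 z.2 0 v, hz, mul_one]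
  have hD : cknD 1 0 P = cknD s z q := by
    rw [hP, cknD_nsZoom hs one_pos z.1 z.2 0 q, hz, mul_one]
  -- the smallness hypothesis of Lemma 6.1
  obtain ⟨G, hG, -⟩ := hIB1.2.2.1
  have hum : AEStronglyMeasurable (uncurry V)
      (volume.restrict (parabolicCylinder 1 (0 : ℝ × EuclideanSpace ℝ (Fin 3)))) :=
    hG.locallyIntegrableOn.aestronglyMeasurable
  have hsm : ∫⁻ w in parabolicCylinder 1 (0 : ℝ × EuclideanSpace ℝ (Fin 3)),
      (‖V w.1 w.2‖ₑ ^ (3 : ℕ) + ‖P w.1 w.2‖ₑ ^ (3 / 2 : ℝ)) < ENNReal.ofReal ε₀ := by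
    have hm : AEMeasurable (fun w : ℝ × EuclideanSpace ℝ (Fin 3) => ‖V w.1 w.2‖ₑ ^ (3 : ℕ))
        (volume.restrict (parabolicCylinder 1 (0 : ℝ × EuclideanSpace ℝ (Fin 3)))) := hum.enorm.pow_const _
    rw [lintegral_add_left' hm]
    have e1 : ∫⁻ w in parabolicCylinder 1 (0 : ℝ × EuclideanSpace ℝ (Fin 3)), ‖V w.1 w.2‖ₑ ^ (3 : ℕ) =
        cknC 1 0 V := by
      simp only [cknC, ENNReal.ofReal_one, one_pow, inv_one, one_mul]
    have e2 : ∫⁻ w in parabolicCylinder 1 (0 : ℝ × EuclideanSpace ℝ (Fin 3)), ‖P w.1 w.2‖ₑ ^ (3 / 2 : ℝ) =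
        cknD 1 0 P := by
      simp only [cknD, ENNReal.ofReal_one, one_pow, inv_one, one_mul]
    rw [e1, e2, hC, hD]
    exact lt_of_le_of_lt hsmall ((ENNReal.ofReal_lt_ofReal_iff hε₀).2 (by linarith))
  exact H V P hIB1 hsm

end Summit.NavierStokesRegularity.NavierStokesRegularity.Theorems.AveragedConeLiouville.SmoothRep

end
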